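import Literature.NumberTheory.EllipticCurves.Kato2004.LocalIwasawaCohomologyMap
import Literature.NumberTheory.EllipticCurves.Kato2004.TateModuleFilAtInertia
import Literature.NumberTheory.GaloisRepresentations.LocalKroneckerWeberInertiaProofs
import Literature.NumberTheory.EllipticCurves.TateModuleContinuityProofs
import Literature.NumberTheory.EllipticCurves.TateModuleFree
import HarnessLib

/-!
# Route `TwoAdicConverse` (rung S3), crux `OrdLambdaHalfAtTwo` (item stmt-BirchSwinnertonDyer-19556), line
# `kato_determinant_greenberg_two` (skeleton v4.7 `59b5c9c4a969`), stub 4‴ `ThetaShapiroKatoGreenbergSupplyAtTwo`: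
# RIGIDITY OF THE ORDINARY LINE — a `Γ_{ℚ_v}`-equivariant isomorphism `u_A : T_pA|_v ≅ T_pW|_v` carries `F⁺_v T_pA` onto `F⁺_v T_pW`,
# hence transports the `F⁺`-part `H_f` of the local Iwasawa cohomology

Cell `bsd-2adic`, seat `bsd-2adic-conv-1` GEN 31 (`--supports stmt-BirchSwinnertonDyer-19556 --as helper`).  WHY: the 4‴ datum
`TwoAdicKatoDeterminant.PinnedKatoCore` reads the twist's first reciprocity law `recA` through W's Coleman map `Col⁻` on
`𝐇¹_loc(T₂W) ⧸ H_f(W)`, the twist's class entering through `𝐇¹(u_A) : 𝐇¹_loc(T₂A) → 𝐇¹_loc(T₂W)`; Kato's per-curve package (tree named fact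
`Kato2004.exists_zetaClass_colemanMinus_recLaw_index_two`, p681779) gives A its OWN Coleman map on `𝐇¹_loc(T₂A) ⧸ H_f(A)`.  To compare the two one
needs `𝐇¹(u_A)(H_f(A)) = H_f(W)` and `𝐇¹(u_A)` bijective — this file — and then the rigidity of finite-cokernel `Λ`-valued functionals (p697478,
`IwasawaAlgebra.exists_unit_mul_C_pow_mul_eq_of_finite_cokernel`).

CONTENT (all kernel except the ONE named input `Kato2004.tateModuleFilAt_inertia_ordinary`, p698222: at a good ordinary `v ∣ p` the inertia group
acts trivially on `T_pE ⧸ F⁺` and by `χ_cyc` on `F⁺`):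
* §1 `mem_tateModuleFilAt_of_pow_smul_mem` — `F⁺_v T_pE` is SATURATED for `p`-powers (Tate-module transition maps; any `K`, `E`, `v`).
* §2 `map_mem_tateModuleFilAt` / `map_tateModuleFilAt_eq` — an inertia-equivariant `ℤ_p`-linear `u : T_pA → T_pW` between curves good ordinary at
  `p` maps `F⁺_A` into `F⁺_W` (onto, for an equivalence): pick `σ ∈ I_v` with `χ_cyc(σ) = 1 + p` (tree theorem
  `adicCompletion_rat_exists_mem_absInertia_cyclotomicCharacter_eq`, local Kronecker–Weber); for `x ∈ F⁺_A`, `σ·u(x) = u(σx) = (1+p)·u(x)` and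
  `σ·u(x) − u(x) ∈ F⁺_W`, so `p·u(x) ∈ F⁺_W`, so `u(x) ∈ F⁺_W` by §1.
* §3 `exists_ordinaryRestrict` — the restriction `u⁺ : F⁺T_pA ⟶ F⁺T_pW` of a morphism `u_A` mapping `F⁺_A` into `F⁺_W`, with `u⁺ ≫ incl_W = incl_A ≫ u_A`;
  `exists_inverse` — a BIJECTIVE morphism of local Tate representations has an inverse morphism (continuity is automatic: the profinite topology of
  `T_p` is the `ℤ_p`-module topology, tree `TateModule.isModuleTopology`); functoriality of `𝐇¹_loc` (`LocalIwasawaH1Data.map_comp_apply` /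
  `map_id_apply`): `𝐇¹(u_A) ∘ ordinaryInclusion_A = ordinaryInclusion_W ∘ 𝐇¹(u⁺)`, `𝐇¹(u_A)(H_f(A)) ≤ H_f(W)`, `𝐇¹(u⁻¹) ∘ 𝐇¹(u) = id`.
* §4 `exists_ordinary_transport` — the package from the named fact, for any bijective `u_A` between curves good ordinary at `p` and `v ∣ p`:
  `u⁺`, a `Λ`-linear two-sided inverse of `𝐇¹(u_A)`, `𝐇¹(u_A)(H_f(A)) = H_f(W)`, `𝐇¹(u_A)⁻¹(H_f(W)) ≤ H_f(A)`.

HONEST FRAMING.  THEOREMS ONLY (the morphisms `u⁺`, `u_A⁻¹` are produced inside existence statements; no definition, no named fact minted here, no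
`sorry`); CONDITIONAL on p698222 where marked; the crux is NOT proved here; BSD is not proved by any of this.
PARTITION (D-0054): none — RANK axis S3 × X5@2 stratum (β); closes none.
-/

open scoped NumberField
open Field IsDedekindDomain WeierstrassCurve CategoryTheory
open Literature.NumberTheory.GaloisRepresentations
open Literature.NumberTheory.EllipticCurves Literature.NumberTheory.EllipticCurves.Kato2004
open Literature.NumberTheory.EllipticCurves.Kato2004.EulerSystemValues


set_option linter.dupNamespace false

noncomputable section

namespace Summit.BirchSwinnertonDyer.BirchSwinnertonDyer.Theorems.TwoAdicOrdinaryLine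

/-! ## §1 Saturation of `F⁺_v T_pE` in `T_pE` (kernel triviality of the transition maps) -/

section Saturation

variable {K : Type} [Field K] [NumberField K] (W : WeierstrassCurve K) (p : ℕ) [Fact p.Prime]
  (v : HeightOneSpectrum (𝓞 K))

/-- **`F⁺_v T_pE` is saturated for `p`-powers**: if `p^k • a ∈ F⁺_v T_pE` then `a ∈ F⁺_v T_pE` (`a_n = p^k • a_{k+n} = (p^k • a)_{k+n}` lies in the
kernel of reduction).  Any number field, curve, place. [cite: SilvermanAEC2009, III.7 (the Tate module; transition maps)] -/
theorem mem_tateModuleFilAt_of_pow_smul_mem {a : W.tateModule p} (k : ℕ)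
    (h : ((p : ℤ_[p]) ^ k • a) ∈ tateModuleFilAt W p v) : a ∈ tateModuleFilAt W p v := by
  rw [mem_tateModuleFilAt_iff] at h ⊢
  intro n
  have := h (k + n)
  rwa [TateModule.proj_pow_smul, TateModule.pow_smul_proj_self_add] at this

/-- `p • a ∈ F⁺_v T_pE → a ∈ F⁺_v T_pE`. [cite: SilvermanAEC2009, III.7] -/
theorem mem_tateModuleFilAt_of_natCast_smul_mem {a : W.tateModule p}
    (h : ((p : ℤ_[p]) • a) ∈ tateModuleFilAt W p v) : a ∈ tateModuleFilAt W p v :=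
  mem_tateModuleFilAt_of_pow_smul_mem W p v 1 (by simpa using h)

end Saturation

/-! ## §2 Rigidity of the ordinary line under equivariant maps -/

section Rigidity

variable (W A : WeierstrassCurve ℚ) [W.IsElliptic] [W.IsGloballyMinimal] [A.IsElliptic] [A.IsGloballyMinimal]
  (p : ℕ) [Fact p.Prime] [ContinuousSMul ℤ_[p] (W.tateModule p)] [ContinuousSMul ℤ_[p] (A.tateModule p)]
  (v : HeightOneSpectrum (𝓞 ℚ))

/-- The place `v` of `ℚ` containing `p` is `(p)`: `primesEquiv v = p` (re-derived locally; cf. `LocalField.primesEquiv_eq_of_natCast_mem`). [folklore] -/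
theorem primesEquiv_eq_of_natCast_mem' (hv : ((p : ℕ) : 𝓞 ℚ) ∈ v.asIdeal) : (Rat.HeightOneSpectrum.primesEquiv v : ℕ) = p := by
  have hp : p.Prime := Fact.out
  have h1 : Rat.HeightOneSpectrum.natGenerator v ∣ p := by
    rw [Rat.HeightOneSpectrum.natGenerator_dvd_iff, Ideal.mem_map_of_equiv]
    exact ⟨p, hv, map_natCast _ p⟩
  exact (Nat.prime_dvd_prime_iff_eq (Rat.HeightOneSpectrum.prime_natGenerator v) hp).mp h1

/-- `1 + p` is a unit of `ℤ_p`. [folklore] -/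
theorem isUnit_one_add_natCast : IsUnit (1 + (p : ℤ_[p])) := by
  rcases IsLocalRing.isUnit_or_isUnit_one_sub_self (1 + (p : ℤ_[p])) with h | h
  · exact h
  · exfalso
    have : IsUnit (p : ℤ_[p]) := by
      have h' : (1 : ℤ_[p]) - (1 + p) = -p := by ring
      rw [h'] at h
      exact (IsUnit.neg_iff _).mp h
    exact PadicInt.prime_p.not_unit this

/-- **Rigidity of the ordinary line.**  For curves `W, A / ℚ` good ordinary at `p`, `v ∣ p`, and a `ℤ_p`-linear `u : T_pA → T_pW` equivariant for
the inertia group `I_v ≤ Γ_{ℚ_v}`: `u(F⁺_v T_pA) ⊆ F⁺_v T_pW`.  From the named fact p698222 (inertia trivial on `T/F⁺`, `χ_cyc` on `F⁺`), an inertia element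
with `χ_cyc = 1 + p` (local Kronecker–Weber, tree theorem), and saturation. [cite: GreenbergLNM1716, §2 (pp. 62–64)]
[cite: SilvermanAEC2009, VII.4 Thm. 4.1 proof (p. 194)] -/
theorem map_mem_tateModuleFilAt (hOrd : tateModuleFilAt_inertia_ordinary) (hW : IsOrdinaryAt W p) (hA : IsOrdinaryAt A p)
    (hv : ((p : ℕ) : 𝓞 ℚ) ∈ v.asIdeal) (u : A.tateModule p →ₗ[ℤ_[p]] W.tateModule p)
    (hu : ∀ σ ∈ absInertia (v.adicCompletion ℚ), ∀ x : A.tateModule p,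
      u ((tateRep A p).toLocal v σ x) = (tateRep W p).toLocal v σ (u x))
    {x : A.tateModule p} (hx : x ∈ tateModuleFilAt A p v) : u x ∈ tateModuleFilAt W p v := by
  obtain ⟨c, hc⟩ := isUnit_one_add_natCast p
  obtain ⟨σ, hσI, hχ⟩ := adicCompletion_rat_exists_mem_absInertia_cyclotomicCharacter_eq p v
    (primesEquiv_eq_of_natCast_mem' p v hv) c
  have h1 := (hOrd W p hW v hv σ hσI).1 (u x)
  have h2 := (hOrd A p hA v hv σ hσI).2 x hx
  rw [hχ, hc] at h2
  have h3 : (tateRep W p).toLocal v σ (u x) = (1 + (p : ℤ_[p])) • u x := by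
    rw [← hu σ hσI x, h2, map_smul]
  rw [h3, add_smul, one_smul, add_sub_cancel_left] at h1
  exact mem_tateModuleFilAt_of_natCast_smul_mem W p v h1

/-- **An inertia-equivariant `ℤ_p`-linear equivalence `T_pA ≃ T_pW` carries `F⁺_v T_pA` ONTO `F⁺_v T_pW`** (both curves good ordinary at `p`).
[cite: GreenbergLNM1716, §2 (pp. 62–64)] -/
theorem map_tateModuleFilAt_eq (hOrd : tateModuleFilAt_inertia_ordinary) (hW : IsOrdinaryAt W p) (hA : IsOrdinaryAt A p)
    (hv : ((p : ℕ) : 𝓞 ℚ) ∈ v.asIdeal) (u : A.tateModule p ≃ₗ[ℤ_[p]] W.tateModule p)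
    (hu : ∀ σ ∈ absInertia (v.adicCompletion ℚ), ∀ x : A.tateModule p,
      u ((tateRep A p).toLocal v σ x) = (tateRep W p).toLocal v σ (u x)) :
    (tateModuleFilAt A p v).map (u : A.tateModule p →ₗ[ℤ_[p]] W.tateModule p) = tateModuleFilAt W p v := by
  apply le_antisymm
  · rintro _ ⟨x, hx, rfl⟩
    exact map_mem_tateModuleFilAt W A p v hOrd hW hA hv u.toLinearMap hu hx
  · intro y hy
    refine ⟨u.symm y, ?_, u.apply_symm_apply y⟩
    have hu' : ∀ σ ∈ absInertia (v.adicCompletion ℚ), ∀ y : W.tateModule p,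
        u.symm ((tateRep W p).toLocal v σ y) = (tateRep A p).toLocal v σ (u.symm y) := fun σ hσ y ↦ by
      apply u.injective
      rw [u.apply_symm_apply, hu σ hσ, u.apply_symm_apply]
    exact map_mem_tateModuleFilAt A W p v hOrd hA hW hv u.symm.toLinearMap hu' hy

end Rigidity

/-! ## §3 Morphisms of local Tate representations: equivariance, inverses, ordinary restriction, functoriality of `𝐇¹_loc` -/

section Morphisms

variable {W A : WeierstrassCurve ℚ} [W.IsElliptic] [A.IsElliptic] {p : ℕ} [Fact p.Prime]
  [ContinuousSMul ℤ_[p] (W.tateModule p)] [ContinuousSMul ℤ_[p] (A.tateModule p)]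
  {κ : ZpExtension ℚ p} {v : HeightOneSpectrum (𝓞 ℚ)} {γᵥ : absoluteGaloisGroup (v.adicCompletion ℚ)}
  (uA : ((tateRep A p).toLocal v).toTopRep ⟶ ((tateRep W p).toLocal v).toTopRep)

/-- Equivariance of a morphism of local Tate representations, on elements. [folklore] -/
theorem hom_toLocal_apply (g : absoluteGaloisGroup (v.adicCompletion ℚ)) (x : A.tateModule p) :
    uA.hom ((tateRep A p).toLocal v g x) = (tateRep W p).toLocal v g (uA.hom x) :=
  TopRep.hom_comm_apply uA g x

/-- **A bijective morphism of local Tate representations has an inverse morphism** (continuity of the inverse is automatic: `T_pW` carries the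
`ℤ_p`-module topology, `TateModule.isModuleTopology`, on which every `ℤ_p`-linear map is continuous). [folklore] -/
theorem exists_inverse (hbij : Function.Bijective uA.hom) :
    ∃ uinv : ((tateRep W p).toLocal v).toTopRep ⟶ ((tateRep A p).toLocal v).toTopRep,
      uA ≫ uinv = 𝟙 _ ∧ uinv ≫ uA = 𝟙 _ := by
  let e : A.tateModule p ≃ₗ[ℤ_[p]] W.tateModule p := LinearEquiv.ofBijective uA.hom.toContinuousLinearMap.toLinearMap hbij
  have he : ∀ x, e x = uA.hom x := fun _ ↦ rfl
  have hcont : Continuous e.symm := by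
    haveI : Module.Finite ℤ_[p] (W.tateModule p) := WeierstrassCurve.module_finite_tateModule_holds W p
    haveI : IsModuleTopology ℤ_[p] (W.tateModule p) := TateModule.isModuleTopology
    exact IsModuleTopology.continuous_of_linearMap e.symm.toLinearMap
  have hequiv : ∀ (g : absoluteGaloisGroup (v.adicCompletion ℚ)) (y : W.tateModule p),
      e.symm ((tateRep W p).toLocal v g y) = (tateRep A p).toLocal v g (e.symm y) := fun g y ↦ by
    apply e.injective
    rw [LinearEquiv.apply_symm_apply, he, hom_toLocal_apply uA g, ← he, LinearEquiv.apply_symm_apply]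
  refine ⟨TopRep.ofHom ⟨⟨e.symm.toLinearMap, hcont⟩, fun g ↦ ContinuousLinearMap.ext fun y ↦ hequiv g y⟩, ?_, ?_⟩
  · refine TopRep.hom_ext (ContIntertwiningMap.ext (ContinuousLinearMap.ext fun x ↦ ?_))
    change e.symm (uA.hom x) = x
    rw [← he, LinearEquiv.symm_apply_apply]
  · refine TopRep.hom_ext (ContIntertwiningMap.ext (ContinuousLinearMap.ext fun y ↦ ?_))
    change uA.hom (e.symm y) = y
    rw [← he, LinearEquiv.apply_symm_apply]

/-- **The ordinary restriction `u⁺ : F⁺T_pA ⟶ F⁺T_pW`** of a morphism mapping `F⁺_A` into `F⁺_W` exists, with `u⁺ ≫ incl_W = incl_A ≫ u_A`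
(the inclusions `tateLocalOrdinaryInclusion` of the sub-representations `T'`). [cite: Kato2004Asterisque, Lemma 17.9 (p. 275) (the sub-representation T')] -/
theorem exists_ordinaryRestrict (h : ∀ x ∈ tateModuleFilAt A p v, uA.hom x ∈ tateModuleFilAt W p v) :
    ∃ u' : (tateLocalOrdinaryRep A p v).toTopRep ⟶ (tateLocalOrdinaryRep W p v).toTopRep,
      u' ≫ tateLocalOrdinaryInclusion W p v = tateLocalOrdinaryInclusion A p v ≫ uA :=
  ⟨TopRep.ofHom
      ⟨((uA.hom.toContinuousLinearMap.comp (tateModuleFilAt A p v).subtypeL).codRestrict (tateModuleFilAt W p v)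
          fun x ↦ h x x.2),
        fun g ↦ ContinuousLinearMap.ext fun x ↦ Subtype.ext (TopRep.hom_comm_apply uA g (x : A.tateModule p))⟩,
    TopRep.hom_ext (ContIntertwiningMap.ext (ContinuousLinearMap.ext fun _ ↦ rfl))⟩

variable (J : LocalIwasawaH1Data κ v ((tateRep W p).toLocal v) γᵥ)
  (J_A : LocalIwasawaH1Data κ v ((tateRep A p).toLocal v) γᵥ)
  (J' : LocalIwasawaH1Data κ v (tateLocalOrdinaryRep W p v) γᵥ)
  (J'_A : LocalIwasawaH1Data κ v (tateLocalOrdinaryRep A p v) γᵥ)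

/-- **`𝐇¹(u_A) ∘ ordinaryInclusion_A = ordinaryInclusion_W ∘ 𝐇¹(u⁺)`** whenever `u⁺ ≫ incl_W = incl_A ≫ u_A` (functoriality of `𝐇¹_loc`).
[cite: Kato2004Asterisque, §12.2 (p. 220) and Lemma 17.9 (p. 275)] -/
theorem map_ordinaryInclusion {u' : (tateLocalOrdinaryRep A p v).toTopRep ⟶ (tateLocalOrdinaryRep W p v).toTopRep}
    (hu' : u' ≫ tateLocalOrdinaryInclusion W p v = tateLocalOrdinaryInclusion A p v ≫ uA) (x : J'_A.H) :
    J_A.map uA J (J'_A.ordinaryInclusion J_A x) = J'.ordinaryInclusion J (J'_A.map u' J' x) := by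
  change J_A.map uA J (J'_A.map (tateLocalOrdinaryInclusion A p v) J_A x) =
    J'.map (tateLocalOrdinaryInclusion W p v) J (J'_A.map u' J' x)
  rw [← LocalIwasawaH1Data.map_comp_apply, ← LocalIwasawaH1Data.map_comp_apply, hu']

/-- **`𝐇¹(u_A)(H_f(A)) ≤ H_f(W)`** whenever `u_A` restricts to the ordinary sub-representations (`H_f = range ordinaryInclusion`; at `p = 2` this is
`localOrdinaryPart` by `rfl`). [cite: Kato2004Asterisque, Lemma 17.9 (p. 275)] -/
theorem map_range_ordinaryInclusion_le {u' : (tateLocalOrdinaryRep A p v).toTopRep ⟶ (tateLocalOrdinaryRep W p v).toTopRep}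
    (hu' : u' ≫ tateLocalOrdinaryInclusion W p v = tateLocalOrdinaryInclusion A p v ≫ uA) :
    (LinearMap.range (J'_A.ordinaryInclusion J_A)).map (J_A.map uA J) ≤ LinearMap.range (J'.ordinaryInclusion J) := by
  rintro _ ⟨_, ⟨x, rfl⟩, rfl⟩
  exact ⟨_, (map_ordinaryInclusion uA J J_A J' J'_A hu' x).symm⟩

/-- `𝐇¹(u⁻¹) ∘ 𝐇¹(u) = id` for `u ≫ u⁻¹ = 𝟙` (functoriality). [cite: Kato2004Asterisque, §12.2 (p. 220)] -/
theorem map_map_of_comp_eq_id {uinv : ((tateRep W p).toLocal v).toTopRep ⟶ ((tateRep A p).toLocal v).toTopRep}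
    (h : uA ≫ uinv = 𝟙 _) (x : J_A.H) : J.map uinv J_A (J_A.map uA J x) = x := by
  rw [← LocalIwasawaH1Data.map_comp_apply, h, LocalIwasawaH1Data.map_id_apply]

end Morphisms

/-! ## §4 The ordinary transport package at a good ordinary prime (from the named fact) -/

section Package

variable {W A : WeierstrassCurve ℚ} [W.IsElliptic] [W.IsGloballyMinimal] [A.IsElliptic] [A.IsGloballyMinimal]
  {p : ℕ} [Fact p.Prime] [ContinuousSMul ℤ_[p] (W.tateModule p)] [ContinuousSMul ℤ_[p] (A.tateModule p)]
  {κ : ZpExtension ℚ p} {v : HeightOneSpectrum (𝓞 ℚ)} {γᵥ : absoluteGaloisGroup (v.adicCompletion ℚ)}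

/-- **THE ORDINARY TRANSPORT PACKAGE** (consumer shape for 4‴): for curves `W, A / ℚ` good ordinary at `p`, `v ∣ p`, a BIJECTIVE morphism
`u_A : T_pA|_v ⟶ T_pW|_v` of local Tate representations and pins `J, J_A` of `𝐇¹_loc(T)`, `J', J'_A` of `𝐇¹_loc(F⁺T)`: there are
`u⁺ : F⁺T_pA ⟶ F⁺T_pW` with `u⁺ ≫ incl_W = incl_A ≫ u_A` and a `Λ`-linear inverse `φinv` of `𝐇¹(u_A)` with
`𝐇¹(u_A) ∘ ordinaryInclusion_A = ordinaryInclusion_W ∘ 𝐇¹(u⁺)`, `𝐇¹(u_A)(H_f(A)) = H_f(W)` and `φinv(H_f(W)) ≤ H_f(A)`.  CONDITIONAL on the named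
fact `Kato2004.tateModuleFilAt_inertia_ordinary` (p698222). [cite: GreenbergLNM1716, §2 (pp. 62–64)] [cite: Kato2004Asterisque, Lemma 17.9 (p. 275)] -/
theorem exists_ordinary_transport (hOrd : tateModuleFilAt_inertia_ordinary) (hW : IsOrdinaryAt W p) (hA : IsOrdinaryAt A p)
    (hv : ((p : ℕ) : 𝓞 ℚ) ∈ v.asIdeal)
    (uA : ((tateRep A p).toLocal v).toTopRep ⟶ ((tateRep W p).toLocal v).toTopRep) (hbij : Function.Bijective uA.hom)
    (J : LocalIwasawaH1Data κ v ((tateRep W p).toLocal v) γᵥ) (J_A : LocalIwasawaH1Data κ v ((tateRep A p).toLocal v) γᵥ)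
    (J' : LocalIwasawaH1Data κ v (tateLocalOrdinaryRep W p v) γᵥ) (J'_A : LocalIwasawaH1Data κ v (tateLocalOrdinaryRep A p v) γᵥ) :
    ∃ (u' : (tateLocalOrdinaryRep A p v).toTopRep ⟶ (tateLocalOrdinaryRep W p v).toTopRep)
      (φinv : J.H →ₗ[IwasawaAlgebra p] J_A.H),
      u' ≫ tateLocalOrdinaryInclusion W p v = tateLocalOrdinaryInclusion A p v ≫ uA ∧
      (∀ x : J'_A.H, J_A.map uA J (J'_A.ordinaryInclusion J_A x) = J'.ordinaryInclusion J (J'_A.map u' J' x)) ∧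
      (∀ x : J_A.H, φinv (J_A.map uA J x) = x) ∧ (∀ y : J.H, J_A.map uA J (φinv y) = y) ∧
      (LinearMap.range (J'_A.ordinaryInclusion J_A)).map (J_A.map uA J) = LinearMap.range (J'.ordinaryInclusion J) ∧
      (LinearMap.range (J'.ordinaryInclusion J)).map φinv ≤ LinearMap.range (J'_A.ordinaryInclusion J_A) := by
  -- `u_A` and its inverse both respect `F⁺`
  obtain ⟨uinv, h1, h2⟩ := exists_inverse uA hbij
  have h : ∀ x ∈ tateModuleFilAt A p v, uA.hom x ∈ tateModuleFilAt W p v := fun _ hx ↦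
    map_mem_tateModuleFilAt W A p v hOrd hW hA hv uA.hom.toContinuousLinearMap.toLinearMap
      (fun σ _ x ↦ TopRep.hom_comm_apply uA σ x) hx
  have h' : ∀ y ∈ tateModuleFilAt W p v, uinv.hom y ∈ tateModuleFilAt A p v := fun _ hy ↦
    map_mem_tateModuleFilAt A W p v hOrd hA hW hv uinv.hom.toContinuousLinearMap.toLinearMap
      (fun σ _ y ↦ TopRep.hom_comm_apply uinv σ y) hy
  obtain ⟨u', hu'⟩ := exists_ordinaryRestrict uA h
  obtain ⟨u'', hu''⟩ := exists_ordinaryRestrict uinv h'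
  have hleft : ∀ x : J_A.H, J.map uinv J_A (J_A.map uA J x) = x := map_map_of_comp_eq_id uA J J_A h1
  have hright : ∀ y : J.H, J_A.map uA J (J.map uinv J_A y) = y := map_map_of_comp_eq_id uinv J_A J h2
  refine ⟨u', J.map uinv J_A, hu', map_ordinaryInclusion uA J J_A J' J'_A hu', hleft, hright, ?_,
    map_range_ordinaryInclusion_le uinv J_A J J'_A J' hu''⟩
  refine le_antisymm (map_range_ordinaryInclusion_le uA J J_A J' J'_A hu') fun y hy ↦ ?_
  exact ⟨_, map_range_ordinaryInclusion_le uinv J_A J J'_A J' hu'' ⟨_, hy, rfl⟩, hright y⟩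

end Package

end Summit.BirchSwinnertonDyer.BirchSwinnertonDyer.Theorems.TwoAdicOrdinaryLine

end
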